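import Summits.NavierStokesRegularity.NavierStokesRegularity.Theorems.QuietScarPocketDoorDefs
import Summits.NavierStokesRegularity.NavierStokesRegularity.Theorems.ScalingDefectPeepholeDoorTubePropagation
import Literature.Analysis.FluidPDE.NSLocalAnalyticityRadiusTube
import Literature.Analysis.Complex.LocallyUniformLimitSCV

/-!
# QuietScarPocketDoorHolomorphicLimit — door S31 «QuietScarPocketDoor», plate P1 part 1/2:
# **PF-c `analyticOfBoundedHolomorphicLimit_holds : AnalyticOfBoundedHolomorphicLimit`** (ns-s29-p2 g3, DIRECTOR-NS #192 (2))

PF-c (texts of record `QuietScarPocketDoorDefs`, = nsreg-p1 g25 Sketch31 v2.1 363b5766493b6c28, ref3 g24 SEAL 09:36Z): a family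
`U t`, `t ∈ (−η,0)`, of maps holomorphic on the fixed local tube `localComplexTube x_c r ρ` with one bound `K`, whose real
restrictions `v t` converge uniformly on `B(x_c,r)` as `t ↑ 0`, has a REAL-ANALYTIC limit `v₀` on `B(x_c,r)`.

PROOF (Montel/Vitali-free, pure several complex variables): about `x₀ ∈ B(x_c,r)` take the thinner tube
`T' = localComplexTube x₀ s (R/2)` with `s = (r − |x₀−x_c|)/2`, `R = min(s,ρ)/2`.  Every `x + iy ∈ T'` is the value at
`ζ = i|y|` (`|ζ| ≤ R/2`) of the complex line `w ↦ x + w·e`, `e = y/|y|`, whose disc `|w| < min(s,ρ)` stays in the big tube and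
whose real diameter lies in `B(x_c,r)`; the two-constants estimate on a disc with real centre (S30 P1,
`ScalingDefectPeepholeDoor.norm_le_two_constants_of_real_diameter`, exponent `Λ = 1 − (2/π)arctan(4/3) > 0`) turns
`sup_{B(x_c,r)} |v t − v t'| ≤ m` into `‖U t − U t'‖ ≤ m^Λ (2K⁺+1)^{1−Λ}` on `T'`.  Hence `(U t)` is uniformly Cauchy on `T'`
as `t ↑ 0`, converges (completeness) uniformly to some `U₀`, holomorphic on `T'` by the several-variable Weierstrass theorem
(`Literature.Analysis.Complex.SCV.analyticOnNhd_of_tendstoLocallyUniformlyOn_of_eventually`), with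
`U₀ ∘ complexify = complexify ∘ v₀` on `B(x₀,s)`; so `v₀` is real-analytic at `x₀` (`analyticAt_of_complexify_eq`: Osgood
analyticity, restriction of scalars, composition with `complexify` and the coordinatewise real part).

WHAT THIS IS NOT: pure complex analysis in support of LEG F of door S31; nothing about door S31 itself, 0056 or NS
regularity is proved here (0056 OPEN; S31 is a criterion door inside a hypothetical Type-I blow-up).
-/

noncomputable section

set_option linter.dupNamespace false

namespace Summit.NavierStokesRegularity.NavierStokesRegularity.Theorems.QuietScarPocketDoor

open MeasureTheory Set Function Filter Topology TopologicalSpace Metric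
open scoped RealInnerProductSpace InnerProductSpace NNReal ENNReal Topology
open Literature.Analysis Literature.Analysis.FluidPDE
open Literature.Analysis.FunctionSpaces.EuclideanSpace (complexify complexify_apply norm_complexify continuous_complexify)
open Summit.NavierStokesRegularity.NavierStokesRegularity.Theorems.ScalingDefectPeepholeDoor
  (line_eq line_ofReal norm_le_two_constants_of_real_diameter twoConstantsExp_pos twoConstantsExp_le_one)

/-! ## §1 Real-analyticity from a holomorphic extension (several variables) -/

/-- **Holomorphic extension ⇒ real-analytic**: if `U₀ : ℂ³ → ℂ³` is complex-analytic at `complexify x₀` and agrees with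
`complexify ∘ f` at the real points near `x₀`, then `f : ℝ³ → ℝ³` is real-analytic at `x₀` (restriction of scalars,
composition with the real-linear maps `complexify` and coordinatewise real part). -/
theorem analyticAt_of_complexify_eq {U₀ : EuclideanSpace ℂ (Fin 3) → EuclideanSpace ℂ (Fin 3)}
    {f : EuclideanSpace ℝ (Fin 3) → EuclideanSpace ℝ (Fin 3)} {x₀ : EuclideanSpace ℝ (Fin 3)}
    (hA : AnalyticAt ℂ U₀ (complexify x₀)) (heq : ∀ᶠ x in 𝓝 x₀, U₀ (complexify x) = complexify (f x)) :
    AnalyticAt ℝ f x₀ := by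
  -- the coordinatewise real part, a real-linear map `ℂ³ → ℝ³`
  set R : EuclideanSpace ℂ (Fin 3) →L[ℝ] EuclideanSpace ℝ (Fin 3) :=
    ((EuclideanSpace.equiv (Fin 3) ℝ).symm : (Fin 3 → ℝ) →L[ℝ] EuclideanSpace ℝ (Fin 3)).comp
      (ContinuousLinearMap.pi fun i =>
        Complex.reCLM.comp ((EuclideanSpace.proj i : EuclideanSpace ℂ (Fin 3) →L[ℂ] ℂ).restrictScalars ℝ)) with hR_def
  have hR : ∀ w : EuclideanSpace ℝ (Fin 3), R (complexify w) = w := by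
    intro w
    ext i
    simp [hR_def]
  have hc : AnalyticAt ℝ (complexify : EuclideanSpace ℝ (Fin 3) → EuclideanSpace ℂ (Fin 3)) x₀ :=
    (complexify : EuclideanSpace ℝ (Fin 3) →ₗᵢ[ℝ] EuclideanSpace ℂ (Fin 3)).toContinuousLinearMap.analyticAt x₀
  have h1 : AnalyticAt ℝ (fun x => U₀ (complexify x)) x₀ := (hA.restrictScalars (𝕜 := ℝ)).comp hc
  have h2 : AnalyticAt ℝ (fun x => R (U₀ (complexify x))) x₀ := (R.analyticAt _).comp h1
  refine h2.congr (heq.mono fun x hx => ?_)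
  simp only [hx, hR]

/-! ## §2 PF-c by name -/

/-- **PF-c · `AnalyticOfBoundedHolomorphicLimit` holds.**  Maps `U t` holomorphic on the fixed local tube
`localComplexTube x_c r ρ`, bounded by `K`, with real restrictions `v t → v₀` uniformly on `B(x_c, r)` as `t ↑ 0`, have a
real-analytic limit `v₀` on `B(x_c, r)`.  Proof (Montel-free): about `x₀ ∈ B(x_c,r)` take the thinner tube
`T' = localComplexTube x₀ s (R/2)`, `s = (r − |x₀ − x_c|)/2`, `R = min(s,ρ)/2`; every point `x + iy ∈ T'` lies at height
`|y| ≤ R/2` on the complex line `w ↦ x + w·(y/|y|)` whose disc of radius `min(s,ρ)` stays in the big tube and whose real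
diameter lies in `B(x_c,r)`; the two-constants estimate (`norm_le_two_constants_of_real_diameter`) turns
`sup_{B(x_c,r)} |v t − v t'| ≤ m` into `‖U t − U t'‖ ≤ m^Λ (2K+1)^{1−Λ}` on `T'`, so `(U t)` is uniformly Cauchy on `T'` as
`t ↑ 0`; its limit `U₀` is holomorphic (`SCV.analyticOnNhd_of_tendstoLocallyUniformlyOn_of_eventually`) and restricts to
`complexify ∘ v₀` on `B(x₀,s)`, whence `v₀` is real-analytic at `x₀` (`analyticAt_of_complexify_eq`). -/
theorem analyticOfBoundedHolomorphicLimit_holds : AnalyticOfBoundedHolomorphicLimit := by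
  intro xc r ρ K η hr hρ hη U v v₀ hUd hUb hUr hcv x₀ hx₀
  rw [mem_ball] at hx₀
  -- geometry about `x₀`
  set d₀ : ℝ := dist x₀ xc with hd₀
  set s : ℝ := (r - d₀) / 2 with hs_def
  have hs : 0 < s := by rw [hs_def]; linarith
  have hsr : d₀ + s + s = r := by rw [hs_def]; ring
  set R₃ : ℝ := min s ρ with hR₃_def
  have hR₃ : 0 < R₃ := lt_min hs hρ
  have hR₃s : R₃ ≤ s := min_le_left _ _
  have hR₃ρ : R₃ ≤ ρ := min_le_right _ _
  set R : ℝ := R₃ / 2 with hR_def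
  have hR : 0 < R := by positivity
  have hRR₃ : R < R₃ := by rw [hR_def]; linarith
  set T' : Set (EuclideanSpace ℂ (Fin 3)) := localComplexTube x₀ s (R / 2) with hT'_def
  have hT'open : IsOpen T' := isOpen_localComplexTube _ _ _
  have hx₀T' : complexify x₀ ∈ T' := complexify_mem_localComplexTube (by positivity) (by simp [hs])
  have hT'T : T' ⊆ localComplexTube xc r ρ := by
    rintro z ⟨x, y, hx, hy, rfl⟩
    refine ⟨x, y, ?_, by linarith, rfl⟩
    calc dist x xc ≤ dist x x₀ + dist x₀ xc := dist_triangle _ _ _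
      _ < s + d₀ := by linarith
      _ < r := by linarith
  -- real points of `B(x₀, s + R₃)` are in `B(x_c, r)`
  have hrealball : ∀ x : EuclideanSpace ℝ (Fin 3), dist x x₀ < s → ∀ e : EuclideanSpace ℝ (Fin 3), ‖e‖ = 1 →
      ∀ a : ℝ, |a| < R₃ → x + a • e ∈ ball xc r := by
    intro x hx e he a ha
    rw [mem_ball]
    calc dist (x + a • e) xc ≤ dist (x + a • e) x + dist x xc := dist_triangle _ _ _
      _ = |a| + dist x xc := by rw [dist_eq_norm, add_sub_cancel_left, norm_smul, he, mul_one, Real.norm_eq_abs]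
      _ ≤ |a| + (dist x x₀ + dist x₀ xc) := by linarith [dist_triangle x x₀ xc]
      _ < R₃ + (s + d₀) := by linarith
      _ ≤ r := by linarith
  -- complex lines through real points of `B(x₀,s)` stay in the big tube up to radius `R₃`
  have hline : ∀ x : EuclideanSpace ℝ (Fin 3), dist x x₀ < s → ∀ e : EuclideanSpace ℝ (Fin 3), ‖e‖ = 1 →
      ∀ w : ℂ, ‖w‖ < R₃ → complexify x + w • complexify e ∈ localComplexTube xc r ρ := by
    intro x hx e he w hw
    rw [line_eq, complexify_add_I_smul_mem_localComplexTube_iff]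
    refine ⟨?_, ?_⟩
    · have h := hrealball x hx e he w.re ((Complex.abs_re_le_norm w).trans_lt hw)
      rwa [mem_ball] at h
    · rw [norm_smul, he, mul_one, Real.norm_eq_abs]
      exact (Complex.abs_im_le_norm w).trans_lt (hw.trans_le hR₃ρ)
  -- constants
  set K' : ℝ := max K 0 with hK'_def
  have hKK' : K ≤ K' := le_max_left _ _
  set M : ℝ := 2 * K' + 1 with hM_def
  have hM : 0 < M := by rw [hM_def]; linarith [le_max_right K 0]
  set μ : ℝ := 2 / Real.pi * Real.arctan (4 / 3) with hμ_def
  set Λ : ℝ := 1 - 2 / Real.pi * Real.arctan (4 / 3) with hΛ_def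
  have hΛ0 : 0 < Λ := twoConstantsExp_pos
  -- KEY: the two-constants estimate on `T'`
  have hkey : ∀ t ∈ Ioo (-η) 0, ∀ t' ∈ Ioo (-η) 0, ∀ m : ℝ, 0 ≤ m → m ≤ M →
      (∀ x ∈ ball xc r, ‖v t x - v t' x‖ ≤ m) → ∀ z ∈ T', ‖U t z - U t' z‖ ≤ m ^ Λ * M ^ μ := by
    intro t ht t' ht' m hm0 hmM hvm z hz
    obtain ⟨x, y, hx, hy, rfl⟩ := hz
    -- the direction `e` and the parameter `ζ` with `x + iy = x + ζ e`, `|ζ| ≤ R/2`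
    obtain ⟨e, ζ, he, hζ, hzeq⟩ : ∃ e : EuclideanSpace ℝ (Fin 3), ∃ ζ : ℂ, ‖e‖ = 1 ∧ ‖ζ‖ ≤ R / 2 ∧
        complexify x + Complex.I • complexify y = complexify x + ζ • complexify e := by
      by_cases hy0 : y = 0
      · refine ⟨EuclideanSpace.basisFun (Fin 3) ℝ 0, 0, (EuclideanSpace.basisFun (Fin 3) ℝ).orthonormal.1 0,
          by rw [norm_zero]; positivity, ?_⟩
        simp [hy0]
      · have hypos : 0 < ‖y‖ := norm_pos_iff.2 hy0
        refine ⟨‖y‖⁻¹ • y, (‖y‖ : ℂ) * Complex.I, ?_, ?_, ?_⟩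
        · rw [norm_smul, norm_inv, norm_norm, inv_mul_cancel₀ hypos.ne']
        · rw [norm_mul, Complex.norm_real, Complex.norm_I, mul_one, Real.norm_of_nonneg hypos.le]; exact hy.le
        · have hne : ((‖y‖ : ℝ) : ℂ) ≠ 0 := by exact_mod_cast hypos.ne'
          rw [LinearIsometry.map_smul, ← Complex.coe_smul, smul_smul, mul_comm, ← mul_assoc, Complex.ofReal_inv,
            inv_mul_cancel₀ hne, one_mul]
    -- the restriction of `U t − U t'` to the line
    set g : ℂ → EuclideanSpace ℂ (Fin 3) :=
      fun w => U t (complexify x + w • complexify e) - U t' (complexify x + w • complexify e) with hg_def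
    have hΦd : Differentiable ℂ fun w : ℂ => complexify x + w • complexify e :=
      (differentiable_id.smul_const _).const_add _
    have hmaps : ∀ w : ℂ, ‖w‖ < R₃ → complexify x + w • complexify e ∈ localComplexTube xc r ρ := hline x hx e he
    have hgd : DifferentiableOn ℂ g (ball (((0 : ℝ) : ℂ)) R₃) := by
      have hsub : MapsTo (fun w : ℂ => complexify x + w • complexify e) (ball (((0 : ℝ) : ℂ)) R₃)
          (localComplexTube xc r ρ) := fun w hw => hmaps w (by simpa using hw)
      exact ((hUd t ht).comp hΦd.differentiableOn hsub).sub ((hUd t' ht').comp hΦd.differentiableOn hsub)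
    have hgM : ∀ w : ℂ, ‖w - ((0 : ℝ) : ℂ)‖ ≤ R → ‖g w‖ ≤ M := by
      intro w hw
      have hwR₃ : ‖w‖ < R₃ := by
        rw [Complex.ofReal_zero, sub_zero] at hw; exact hw.trans_lt hRR₃
      have hmem := hmaps w hwR₃
      calc ‖g w‖ ≤ ‖U t (complexify x + w • complexify e)‖ + ‖U t' (complexify x + w • complexify e)‖ :=
            norm_sub_le _ _
        _ ≤ K + K := add_le_add (hUb t ht _ hmem) (hUb t' ht' _ hmem)
        _ ≤ M := by rw [hM_def]; linarith
    have hgm : ∀ a : ℝ, |a - 0| < R → ‖g a‖ ≤ m := by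
      intro a ha
      rw [sub_zero] at ha
      have hmem : x + a • e ∈ ball xc r := hrealball x hx e he a (ha.trans hRR₃)
      simp only [hg_def, line_ofReal]
      rw [hUr t ht _ hmem, hUr t' ht' _ hmem, ← map_sub, norm_complexify]
      exact hvm _ hmem
    have h2c := norm_le_two_constants_of_real_diameter (c := (0 : ℝ)) (R := R) (R₃ := R₃) (m := m) (K := M)
      hR hRR₃ hgd hm0 hmM hgM hgm (w := ζ) (by rw [Complex.ofReal_zero, sub_zero]; exact hζ)
    rw [← hΛ_def, ← hμ_def] at h2c
    rw [hzeq]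
    simpa only [hg_def] using h2c
  -- smallness of `m ^ Λ * M ^ μ`
  have hsmall : ∀ ε : ℝ, 0 < ε → ∃ m : ℝ, 0 < m ∧ m ≤ M ∧ m ^ Λ * M ^ μ < ε := by
    intro ε hε
    have hMμ : 0 < M ^ μ := Real.rpow_pos_of_pos hM _
    set a : ℝ := ε / (2 * M ^ μ) with ha_def
    have ha : 0 < a := by positivity
    refine ⟨min M (a ^ Λ⁻¹), lt_min hM (Real.rpow_pos_of_pos ha _), min_le_left _ _, ?_⟩
    have h1 : (min M (a ^ Λ⁻¹)) ^ Λ ≤ (a ^ Λ⁻¹) ^ Λ :=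
      Real.rpow_le_rpow (le_min hM.le (Real.rpow_nonneg ha.le _)) (min_le_right _ _) hΛ0.le
    rw [Real.rpow_inv_rpow ha.le hΛ0.ne'] at h1
    calc (min M (a ^ Λ⁻¹)) ^ Λ * M ^ μ ≤ a * M ^ μ := mul_le_mul_of_nonneg_right h1 hMμ.le
      _ = ε / 2 := by rw [ha_def]; field_simp
      _ < ε := by linarith
  -- `(U t)` is uniformly Cauchy on `T'` as `t ↑ 0`
  have hIoo : Ioo (-η) 0 ∈ 𝓝[<] (0 : ℝ) := Ioo_mem_nhdsLT (by linarith)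
  have hC : UniformCauchySeqOn U (𝓝[<] (0 : ℝ)) T' := by
    intro u hu
    obtain ⟨ε, hε, hεu⟩ := Metric.mem_uniformity_dist.1 hu
    obtain ⟨m, hm0, hmM, hmε⟩ := hsmall ε hε
    have hvC := hcv.uniformCauchySeqOn _ (Metric.dist_mem_uniformity hm0)
    have hI : ∀ᶠ p in (𝓝[<] (0 : ℝ)) ×ˢ (𝓝[<] (0 : ℝ)), p.1 ∈ Ioo (-η) 0 ∧ p.2 ∈ Ioo (-η) 0 :=
      Filter.prod_mem_prod hIoo hIoo
    filter_upwards [hvC, hI] with p hp hpI z hz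
    apply hεu
    rw [dist_eq_norm]
    refine lt_of_le_of_lt (hkey p.1 hpI.1 p.2 hpI.2 m hm0.le hmM (fun x hx => ?_) z hz) hmε
    have h : dist (v p.1 x) (v p.2 x) < m := hp x hx
    rw [← dist_eq_norm]; exact h.le
  -- pointwise limits on `T'` (completeness) and the limit map
  have hex : ∀ z ∈ T', ∃ w, Tendsto (fun t => U t z) (𝓝[<] (0 : ℝ)) (𝓝 w) := by
    intro z hz
    apply cauchy_map_iff_exists_tendsto.1
    rw [cauchy_map_iff', Metric.uniformity_basis_dist.tendsto_right_iff]
    intro ε hε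
    exact (hC _ (Metric.dist_mem_uniformity hε)).mono fun p hp => hp z hz
  set U₀ : EuclideanSpace ℂ (Fin 3) → EuclideanSpace ℂ (Fin 3) :=
    fun z => limUnder (𝓝[<] (0 : ℝ)) (fun t => U t z) with hU₀_def
  have hU₀ : ∀ z ∈ T', Tendsto (fun t => U t z) (𝓝[<] (0 : ℝ)) (𝓝 (U₀ z)) :=
    fun z hz => tendsto_nhds_limUnder (hex z hz)
  have hunif : TendstoUniformlyOn U U₀ (𝓝[<] (0 : ℝ)) T' := hC.tendstoUniformlyOn_of_tendsto hU₀
  have hA : AnalyticOnNhd ℂ U₀ T' :=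
    Literature.Analysis.Complex.SCV.analyticOnNhd_of_tendstoLocallyUniformlyOn_of_eventually hT'open
      (mem_of_superset hIoo fun t ht => (hUd t ht).mono hT'T) hunif.tendstoLocallyUniformlyOn
  -- the limit restricts to `complexify ∘ v₀` on `B(x₀, s)`
  have hreal : ∀ x : EuclideanSpace ℝ (Fin 3), dist x x₀ < s → U₀ (complexify x) = complexify (v₀ x) := by
    intro x hx
    have hxT' : complexify x ∈ T' := complexify_mem_localComplexTube (by positivity) hx
    have hxB : x ∈ ball xc r := by
      have h := hrealball x hx (EuclideanSpace.basisFun (Fin 3) ℝ 0) ((EuclideanSpace.basisFun (Fin 3) ℝ).orthonormal.1 0)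
        0 (by simpa using hR₃)
      simpa using h
    have h1 := hU₀ _ hxT'
    have h2 : Tendsto (fun t => U t (complexify x)) (𝓝[<] (0 : ℝ)) (𝓝 (complexify (v₀ x))) := by
      have hv : Tendsto (fun t => complexify (v t x)) (𝓝[<] (0 : ℝ)) (𝓝 (complexify (v₀ x))) :=
        (continuous_complexify.tendsto _).comp (hcv.tendsto_at hxB)
      refine hv.congr' ?_
      filter_upwards [hIoo] with t ht
      exact (hUr t ht x hxB).symm
    exact tendsto_nhds_unique h1 h2
  -- conclusion
  exact analyticAt_of_complexify_eq (hA _ hx₀T')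
    (mem_of_superset (ball_mem_nhds x₀ hs) fun x hx => hreal x (mem_ball.1 hx))

end Summit.NavierStokesRegularity.NavierStokesRegularity.Theorems.QuietScarPocketDoor

end
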